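import Mathlib
import Summits.NavierStokesRegularity.NavierStokesRegularity.Theorems.FilamentSkeletonRssSkeletonJ1RLiaSelfDerivZones

/-!
# Crux `SkeletonJ1R` (stmt-NavierStokesRegularity-23610) · line `streamline_kantorovich_R` · toward stub F2-d (`LiaDefectDerivBL`, v7), window brick for S2′ of B1′:
# THE RADIAL FACTOR `⟪Xτ − Xσ, X′τ − X′σ⟫` IS FOURTH ORDER (second cancellation of the symmetrized self-strand derivative integrand)

Hand `leafhand-ns-filamentskeletonrs-1` (gen 0), `--supports stmt-NavierStokesRegularity-23610 --as helper`.  MODEL rung, NEGATIVE side of the ladder: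
elementary calculus of curves for a HYPOTHETICAL filament-type blow-up skeleton; nothing here is a claim about Navier–Stokes regularity; the stub and the crux
stay OPEN.

On the logarithmic window `|s| ≤ R ≍ √Γ` of the derivative local-induction estimate (plan `B1prime-PLAN-leafhand-g0.md`, crux evidence #53) the first term
`(−3⟪w, X′τ − X′σ⟫K₅(w))•X′σ×w` of the symmetrized integrand must be `O(κH)` pointwise — the third-order bound `(3/2)κ²|s|³` of `…LiaSelfDerivZones`
(enough for the envelope zone) would leave `κ²∫ds/|s| = κ² log(R/e)`, a factor `√log Γ` over the RATE-B budget.  The extra order comes from a SECOND exact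
cancellation, valid for every unit-speed `C²` curve with `H`-Lipschitz curvature (no `C³` needed):
* `inner_chord_tangentIncrement_eq` : with `Δ = X′τ − X′σ`, `r₂ = Δ − (τ−σ)•X″σ`, `r₃ = Xτ − Xσ − (τ−σ)•X′σ − ((τ−σ)²/2)•X″σ`,
  `⟪Xτ − Xσ, Δ⟫ = −((τ−σ)/2)⟪Δ, r₂⟫ + ⟪r₃, Δ⟫` (the `(τ−σ)²⟪X″σ, Δ⟫` terms cancel because `⟪X′σ, Δ⟫ = −‖Δ‖²/2` for unit tangents);
* `abs_inner_chord_tangentIncrement_le_fourth` : `|⟪Xτ − Xσ, X′τ − X′σ⟫| ≤ (3/2)·κ·H·(τ−σ)⁴` (`‖X″‖ ≤ κ` on `[[σ,τ]]`, `‖X″q − X″σ‖ ≤ H|q−σ|`).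
Consequently the first term is `≤ (9/2)κH(τ−σ)⁴‖w‖K₅(w) = O(κH)` on the window, whose integral `O(κHR)` is within budget (`ℓΓκHR ≍ Rb²√Γ/log Γ`).
-/

set_option linter.dupNamespace false -- `NavierStokesRegularity.NavierStokesRegularity` path/namespace repetition is the tree convention

noncomputable section

namespace Summit.NavierStokesRegularity.NavierStokesRegularity.Theorems.SkeletonJ1RLiaSelf

open Set Function Filter Real Topology MeasureTheory
open Literature.Analysis.FluidPDE
open scoped InnerProductSpace BigOperators

variable {X : ℝ → EuclideanSpace ℝ (Fin 3)}

/-- **The second cancellation (exact)**: `⟪Xτ − Xσ, Δ⟫ = −((τ−σ)/2)⟪Δ, r₂⟫ + ⟪r₃, Δ⟫` for a unit-speed `C¹` curve (notation of the docstring). [folklore] -/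
theorem inner_chord_tangentIncrement_eq (hunit : ∀ s, ‖deriv X s‖ = 1) (τ σ : ℝ) :
    ⟪X τ - X σ, deriv X τ - deriv X σ⟫_ℝ =
      -((τ - σ) / 2) * ⟪deriv X τ - deriv X σ, deriv X τ - deriv X σ - (τ - σ) • deriv (deriv X) σ⟫_ℝ +
        ⟪X τ - X σ - (τ - σ) • deriv X σ - ((τ - σ) ^ 2 / 2) • deriv (deriv X) σ, deriv X τ - deriv X σ⟫_ℝ := by
  set Δ := deriv X τ - deriv X σ with hΔ
  set r₂ := deriv X τ - deriv X σ - (τ - σ) • deriv (deriv X) σ with hr₂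
  set r₃ := X τ - X σ - (τ - σ) • deriv X σ - ((τ - σ) ^ 2 / 2) • deriv (deriv X) σ with hr₃
  have hunitI : ⟪Δ, deriv X σ⟫_ℝ = -‖Δ‖ ^ 2 / 2 := inner_sub_right_of_unit (hunit σ) (hunit τ)
  have hw : X τ - X σ = (τ - σ) • deriv X σ + ((τ - σ) ^ 2 / 2) • deriv (deriv X) σ + r₃ := by rw [hr₃]; abel
  have hΔb : Δ = (τ - σ) • deriv (deriv X) σ + r₂ := by rw [hr₂, hΔ]; abel
  have h1 : ⟪X τ - X σ, Δ⟫_ℝ = (τ - σ) * ⟪deriv X σ, Δ⟫_ℝ + (τ - σ) ^ 2 / 2 * ⟪deriv (deriv X) σ, Δ⟫_ℝ + ⟪r₃, Δ⟫_ℝ := by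
    rw [hw, inner_add_left, inner_add_left, inner_smul_left, inner_smul_left]; simp only [conj_trivial]
  have h2 : ⟪deriv X σ, Δ⟫_ℝ = -‖Δ‖ ^ 2 / 2 := by rw [← real_inner_comm (deriv X σ) Δ]; exact hunitI
  have h3 : ‖Δ‖ ^ 2 = (τ - σ) * ⟪Δ, deriv (deriv X) σ⟫_ℝ + ⟪Δ, r₂⟫_ℝ := by
    have h := congrArg (fun v => ⟪Δ, v⟫_ℝ) hΔb
    simp only [inner_add_right, inner_smul_right, real_inner_self_eq_norm_sq] at h
    exact h
  have h4 : ⟪deriv (deriv X) σ, Δ⟫_ℝ = ⟪Δ, deriv (deriv X) σ⟫_ℝ := real_inner_comm _ _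
  rw [h1, h2, h3, h4]; ring

/-- **`|⟪Xτ − Xσ, X′τ − X′σ⟫| ≤ (3/2)κH(τ−σ)⁴`** for a unit-speed `C²` curve with `‖X″‖ ≤ κ` on `[[σ, τ]]` and `‖X″q − X″σ‖ ≤ H|q − σ|` there. [folklore] -/
theorem abs_inner_chord_tangentIncrement_le_fourth (hX : ContDiff ℝ 2 X) (hunit : ∀ s, ‖deriv X s‖ = 1) {τ σ κ H : ℝ}
    (hκ : ∀ p ∈ uIcc σ τ, ‖deriv (deriv X) p‖ ≤ κ) (hH0 : 0 ≤ H)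
    (hH : ∀ q ∈ uIcc σ τ, ‖deriv (deriv X) q - deriv (deriv X) σ‖ ≤ H * |q - σ|) :
    |⟪X τ - X σ, deriv X τ - deriv X σ⟫_ℝ| ≤ 3 / 2 * κ * H * (τ - σ) ^ 4 := by
  have hκ0 : 0 ≤ κ := (norm_nonneg _).trans (hκ σ left_mem_uIcc)
  have hΔn : ‖deriv X τ - deriv X σ‖ ≤ κ * |τ - σ| := norm_deriv_sub_deriv_le_on hX (τ := σ) (σ := τ) hκ
  have hr₂n : ‖deriv X τ - deriv X σ - (τ - σ) • deriv (deriv X) σ‖ ≤ H * (τ - σ) ^ 2 := norm_derivIncrement_sub_model_le hX hH0 hH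
  have hr₃n : ‖X τ - X σ - (τ - σ) • deriv X σ - ((τ - σ) ^ 2 / 2) • deriv (deriv X) σ‖ ≤ H * |τ - σ| ^ 3 := norm_taylorThree_le hX hH0 hH
  rw [inner_chord_tangentIncrement_eq hunit τ σ, show (τ - σ) ^ 4 = (|τ - σ| ^ 2) ^ 2 by rw [sq_abs]; ring]
  rw [← sq_abs (τ - σ)] at hr₂n
  have hs0 := abs_nonneg (τ - σ)
  calc |-((τ - σ) / 2) * ⟪deriv X τ - deriv X σ, deriv X τ - deriv X σ - (τ - σ) • deriv (deriv X) σ⟫_ℝ +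
        ⟪X τ - X σ - (τ - σ) • deriv X σ - ((τ - σ) ^ 2 / 2) • deriv (deriv X) σ, deriv X τ - deriv X σ⟫_ℝ|
      ≤ |-((τ - σ) / 2) * ⟪deriv X τ - deriv X σ, deriv X τ - deriv X σ - (τ - σ) • deriv (deriv X) σ⟫_ℝ| +
        |⟪X τ - X σ - (τ - σ) • deriv X σ - ((τ - σ) ^ 2 / 2) • deriv (deriv X) σ, deriv X τ - deriv X σ⟫_ℝ| := abs_add_le _ _
    _ ≤ |τ - σ| / 2 * (‖deriv X τ - deriv X σ‖ * ‖deriv X τ - deriv X σ - (τ - σ) • deriv (deriv X) σ‖) +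
        ‖X τ - X σ - (τ - σ) • deriv X σ - ((τ - σ) ^ 2 / 2) • deriv (deriv X) σ‖ * ‖deriv X τ - deriv X σ‖ := by
        refine add_le_add ?_ (abs_real_inner_le_norm _ _)
        rw [abs_mul, show |-((τ - σ) / 2)| = |τ - σ| / 2 by rw [abs_neg, abs_div, abs_two]]
        exact mul_le_mul_of_nonneg_left (abs_real_inner_le_norm _ _) (by positivity)
    _ ≤ |τ - σ| / 2 * ((κ * |τ - σ|) * (H * |τ - σ| ^ 2)) + (H * |τ - σ| ^ 3) * (κ * |τ - σ|) := by
        gcongr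
    _ = 3 / 2 * κ * H * (|τ - σ| ^ 2) ^ 2 := by ring

end Summit.NavierStokesRegularity.NavierStokesRegularity.Theorems.SkeletonJ1RLiaSelf

end
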